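import Summits.CriticalPhenomena.PercolationContinuityZ3.Theorems.PercNearOneGluingNoHeavyLowerTailCovTauA2H
import Summits.CriticalPhenomena.PercolationContinuityZ3.Theorems.PercNearOneGluingNoHeavyLowerTailCovTauBridge
import Summits.CriticalPhenomena.PercolationContinuityZ3.Theorems.PercNearOneGluingNoHeavyLowerTailCSHUnfoldOneTools
import Summits.CriticalPhenomena.PercolationContinuityZ3.Theorems.PercNearOneGluingNoHeavyLowerTailHullPortCSHDefs
import Summits.CriticalPhenomena.PercolationContinuityZ3.Theorems.PercNearOneGluingNoHeavyLowerTailHullPortTABase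
import HarnessLib

/-!
# Crux `NoHeavyLowerTail` (stmt-CriticalPhenomena-4575): (Htw) IN THE WORLD VOCABULARY of the CSH chain
# (`HullPort.delE / cut / avoidEv`, `CSH.wmeanOff / wcovOff`)

Support file (`--supports stmt-CriticalPhenomena-4575`, prover prim-hp-4 gen 11).  No named facts, no sorries, no
`Prop` definitions.  Dictionary half of socket piece P4 of prim-hp-8/SOCKET-CSH-LEAN.md ("OUTPUT NEEDED DOWNSTREAM
(diagonal, 'Htw')"), for the `k = 1` cell assembly (`…CSHCellOne`, prim-ineq-prove-5) and Theorem 1 (`…CSHMain`,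
prim-ineq-prove-1) of the general-`r` surplus-transfer programme (memo prim-hp-8/PROOF-S5-ALL-R.md, Lemma H).

`CovTau.p1H_univ` (`…CovTauA2H.lean`) states (Htw) in prim-hp-4's `G[U]`-restriction framework at `U = univ`:
  `E_S(Y)·Y^H(Y) ≤ M_S(Y)·X^H(Y)`.
The CSH files describe the world of `ω` by DELETING the pairs `cut Y ω` meeting the open vertex cluster `C_Y(ω)` and
keeping the weights (`HullPort.delE`, `CSH.wmeanOff w Y φ ω = Σ_η w(η) φ(η ∖ cut Y ω)`, `CSH.wcovOff` = the world
covariance).  Restricting a configuration to `edgesIn (V ∖ C_Y(ω))` IS deleting `cut Y ω`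
(`CovTau.inter_edgesIn_rest_univ_set`), so the two bookkeepings agree definitionally up to this set identity.  THIS FILE
records the dictionary (`tfE / cfS / BfS / Mav / Eav / qav` of the world `rest univ Y ω` as `wmeanOff / wcovOff`;
`Eav / Mav / Yw / Xw` at `U = univ` as plain weight sums with `HullPort.avoidEv`) and restates (Htw):
* `CovTau.htw_world` — for a marker set `S ∋ x` with `v ∉ S`, any source set `Y`, monotone edge-cluster functional
  `g ≥ 0`, weights `w ∈ [0,1]` (normalised):
  `μ(v ↔ o, v ↮ S ∪ Y) · Σ_ω w(ω) 1{x ↮ Y} Cov_{G − cut Y ω}(g(C_x), 1{v ↔ S})`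
  `  ≤ μ(v ↮ S ∪ Y) · Σ_ω w(ω) 1{x ↮ Y} p^S_ω · Cov_{G − cut Y ω}(g(C_x), 1{v ↔ S})`,
  `p^S_ω = μ_{G − cut Y ω}(v ↔ o, v ↮ S) / μ_{G − cut Y ω}(v ↮ S)`;
* `CovTau.htw_world_pair` — the case `S = {x, d}` (owner and one decoy) with `{v ↔ S} = openConn x v ∪ openConn d v`
  and `S ∪ Y = insert x (insert d Y)`, literally the threshold form of the H-part of `CSH.unfold_one`.
* `CovTau.htw_delE` — the same for `unitInterval` weights `q < 1` in prim-ineq-prove-5's `HullPort.delE / covW` vocabulary with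
  the threshold `p = μ(v ↔ o | v ↮ {x,d} ∪ Y)` given by its defining equation: LITERALLY the hypothesis `HTW` of
  `HullPort.hpart_nonneg` / `HullPort.csh_one` (`…CSHCellOne.lean`), i.e.
  `0 ≤ Σ_ω q(ω) 1{x ↮ Y} (p_ω − p) Cov_{G − cut Y ω}(g(C_x), 1{v ↔ {x,d}})`.
Combined with the world-wise set four-point inequality (K6) this is Lemma H (Hpart ≥ 0) of the memo.
[cite: VandenbergHaggstromKahn2005, Thm. 1.1 (pp. 3–5), §1 p. 4 (induced model), Thm. 1.4 (p. 7)]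
[cite: Gladkov2024, Thm. 3.2 (p. 4)] [cite: KozmaNitzan2024, Conj. 1 (p. 3)]
-/

noncomputable section

namespace Summit.CriticalPhenomena.PercolationContinuityZ3.Theorems.CovTau

open Set MeasureTheory Literature.Probability.LatticeModels Literature.Probability.Percolation
open Literature.Probability.Percolation.BHK2006
open Literature.Probability.Percolation.DecisionTree (ind ind_of_mem ind_of_not_mem ind_nonneg)
open HullPort (delE cut avoidEv)
open CSH (wmeanOff wcovOff)
open scoped Classical

variable {V : Type*} [Fintype V]

/-! ### The world `rest univ Y ω = V ∖ C_Y(ω)`: restriction = deletion of `cut Y ω` -/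

/-- In the world `V ∖ C_Y(ω)`, restricting a configuration to the pairs inside the world deletes exactly the pairs
meeting the open vertex cluster of `Y` (`HullPort.cut`). [cite: VandenbergHaggstromKahn2005, §1 p. 4 (induced model)] -/
theorem inter_edgesIn_rest_univ_set (Y : Set V) (ω η : Set (Sym2 V)) :
    η ∩ edgesIn (rest Finset.univ Y ω) = η \ cut Y ω := by
  ext e
  simp only [mem_inter_iff, BHK2006.edgesIn, mem_setOf_eq, mem_sdiff, HullPort.cut, not_exists, not_and]
  constructor
  · rintro ⟨he, h⟩
    refine ⟨he, fun u hu y hy hr => ?_⟩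
    exact (mem_rest.1 (h u hu)).2 (mem_sC_univ.2 ⟨y, hy, hr⟩)
  · rintro ⟨he, h⟩
    refine ⟨he, fun u hu => mem_rest.2 ⟨Finset.mem_univ u, fun hC => ?_⟩⟩
    obtain ⟨y, hy, hr⟩ := mem_sC_univ.1 hC
    exact h u hu y hy hr

/-- `rD univ s X = {s ↮ X} = HullPort.avoidEv s X`. [folklore] -/
theorem rD_univ_eq_avoidEv (s : V) (X : Set V) : rD (Finset.univ : Finset V) s X = avoidEv s X := by
  rw [rD_univ]; rfl

/-- An indicator evaluated through a preimage: `1_{ {η | P (η ∖ B)} }(η) = 1_{ {β | P β} }(η ∖ B)`. [folklore] -/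
theorem ind_setOf_comp {α : Type*} (P : α → Prop) (f : α → α) (a : α) :
    ind {a | P (f a)} a = ind {b | P b} (f a) := by
  by_cases h : P (f a)
  · rw [ind_of_mem (show a ∈ {a | P (f a)} from h), ind_of_mem (show f a ∈ {b | P b} from h)]
  · rw [ind_of_not_mem (show a ∉ {a | P (f a)} from h), ind_of_not_mem (show f a ∉ {b | P b} from h)]

omit [Fintype V] in
/-- `1{v ↔ S}` of a depleted configuration. [folklore] -/
theorem ind_reach_sdiff (S : Set V) (v : V) (B η : Set (Sym2 V)) :
    ind {β : Set (Sym2 V) | ∃ s ∈ S, (openGraph (β \ B)).Reachable s v} η =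
      ind {β : Set (Sym2 V) | ∃ s ∈ S, (openGraph β).Reachable s v} (η \ B) :=
  ind_setOf_comp (fun β : Set (Sym2 V) => ∃ s ∈ S, (openGraph β).Reachable s v) (fun β => β \ B) η

omit [Fintype V] in
/-- `1{v ↮ S}` of a depleted configuration. [folklore] -/
theorem ind_avoid_sdiff (S : Set V) (v : V) (B η : Set (Sym2 V)) :
    ind {β : Set (Sym2 V) | ∀ a ∈ S, ¬ (openGraph (β \ B)).Reachable v a} η = ind (avoidEv v S) (η \ B) :=
  ind_setOf_comp (fun β : Set (Sym2 V) => ∀ a ∈ S, ¬ (openGraph β).Reachable v a) (fun β => β \ B) η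

omit [Fintype V] in
/-- `1{v ↔ o}` of a depleted configuration. [folklore] -/
theorem ind_conn_sdiff (v o : V) (B η : Set (Sym2 V)) :
    ind {β : Set (Sym2 V) | (openGraph (β \ B)).Reachable v o} η = ind (openConn v o : Set (BondConfig V)) (η \ B) :=
  ind_setOf_comp (fun β : Set (Sym2 V) => (openGraph β).Reachable v o) (fun β => β \ B) η

section World

variable (w : Sym2 V → ℝ) (Y : Set V) (ω : Set (Sym2 V))

/-- `t` of the world: `tfE (V ∖ C_Y ω) x g = ḡ = wmeanOff w Y (g ∘ C_x) ω`. [folklore] -/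
theorem tfE_rest_univ (x : V) (g : Set (Sym2 V) → ℝ) :
    tfE w (rest Finset.univ Y ω) x g = wmeanOff w Y (fun β => g (openEdgeCluster β x)) ω := by
  unfold tfE CSH.wmeanOff
  refine Finset.sum_congr rfl fun η _ => ?_
  rw [rC, inter_edgesIn_rest_univ_set]

/-- `μ_world(v ↔ S) = wmeanOff w Y 1{v ↔ S} ω`. [folklore] -/
theorem cfS_rest_univ (S : Set V) (v : V) :
    cfS w (rest Finset.univ Y ω) S v =
      wmeanOff w Y (ind {β : Set (Sym2 V) | ∃ s ∈ S, (openGraph β).Reachable s v}) ω := by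
  unfold cfS CSH.wmeanOff
  refine Finset.sum_congr rfl fun η _ => ?_
  simp only [inter_edgesIn_rest_univ_set, ind_reach_sdiff]

/-- **`H` of the world is the CSH world covariance**:
`BfS (V ∖ C_Y ω) x S v g = Cov_{G − cut Y ω}(g(C_x), 1{v ↔ S}) = wcovOff w Y (g ∘ C_x) 1{v ↔ S} ω`.
[cite: VandenbergHaggstromKahn2005, §1 p. 4 (induced model)] -/
theorem BfS_rest_univ (x : V) (S : Set V) (v : V) (g : Set (Sym2 V) → ℝ) :
    BfS w (rest Finset.univ Y ω) x S v g =
      wcovOff w Y (fun β => g (openEdgeCluster β x))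
        (ind {β : Set (Sym2 V) | ∃ s ∈ S, (openGraph β).Reachable s v}) ω := by
  rw [CSH.wcovOff, ← tfE_rest_univ, ← cfS_rest_univ, BfS]
  congr 1
  unfold CSH.wmeanOff
  refine Finset.sum_congr rfl fun η _ => ?_
  simp only [rC, inter_edgesIn_rest_univ_set, ind_reach_sdiff]

/-- `M_S(∅)` of the world: `μ_{G − cut Y ω}(v ↮ S) = wmeanOff w Y 1{v ↮ S} ω`. [folklore] -/
theorem Mav_rest_univ_empty (S : Set V) (v : V) :
    Mav w (rest Finset.univ Y ω) S v ∅ = wmeanOff w Y (ind (avoidEv v S)) ω := by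
  unfold Mav CSH.wmeanOff
  refine Finset.sum_congr rfl fun η _ => ?_
  rw [Set.union_empty, rD]
  simp only [inter_edgesIn_rest_univ_set, ind_avoid_sdiff]

/-- `E_S(∅)` of the world: `μ_{G − cut Y ω}(v ↔ o, v ↮ S) = wmeanOff w Y 1{v ↮ S, v ↔ o} ω`. [folklore] -/
theorem Eav_rest_univ_empty (S : Set V) (o v : V) :
    Eav w (rest Finset.univ Y ω) S o v ∅ =
      wmeanOff w Y (ind (avoidEv v S ∩ (openConn v o : Set (BondConfig V)))) ω := by
  unfold Eav CSH.wmeanOff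
  refine Finset.sum_congr rfl fun η _ => ?_
  rw [Set.union_empty, oInd_rC, rD, ind_inter]
  simp only [inter_edgesIn_rest_univ_set, ind_avoid_sdiff, ind_conn_sdiff]
  ring

/-- `q_S` of the world: `μ_{G − cut Y ω}(v ↔ o | v ↮ S)` as a quotient of world means. [folklore] -/
theorem qav_rest_univ (S : Set V) (o v : V) :
    qav w (rest Finset.univ Y ω) S o v =
      wmeanOff w Y (ind (avoidEv v S ∩ (openConn v o : Set (BondConfig V)))) ω /
        wmeanOff w Y (ind (avoidEv v S)) ω := by
  rw [qav, Eav_rest_univ_empty, Mav_rest_univ_empty]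

end World

/-! ### The functionals at `U = univ` -/

/-- `M_S(Y) = μ(v ↮ S ∪ Y)` on the whole graph. [folklore] -/
theorem Mav_univ (w : Sym2 V → ℝ) (S : Set V) (v : V) (Y : Set V) :
    Mav w Finset.univ S v Y = ∑ ω, weight w ω * ind (avoidEv v (S ∪ Y)) ω := by
  unfold Mav; simp only [rD_univ_eq_avoidEv]

/-- `E_S(Y) = μ(v ↔ o, v ↮ S ∪ Y)` on the whole graph. [folklore] -/
theorem Eav_univ (w : Sym2 V → ℝ) (S : Set V) (o v : V) (Y : Set V) :
    Eav w Finset.univ S o v Y =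
      ∑ ω, weight w ω * ind (avoidEv v (S ∪ Y) ∩ (openConn v o : Set (BondConfig V))) ω := by
  unfold Eav
  refine Finset.sum_congr rfl fun ω _ => ?_
  rw [rC_univ, oInd_openEdgeCluster, rD_univ_eq_avoidEv, ind_inter, mul_comm (ind (avoidEv v (S ∪ Y)) ω)]

/-- `Y_F(Y) = Σ_ω w(ω) 1{x ↮ Y} F(V ∖ C_Y ω)` on the whole graph. [folklore] -/
theorem Yw_univ (w : Sym2 V → ℝ) (x : V) (F : Finset V → ℝ) (Y : Set V) :
    Yw w Finset.univ x F Y = ∑ ω, weight w ω * (ind (avoidEv x Y) ω * F (rest Finset.univ Y ω)) := by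
  unfold Yw
  refine Finset.sum_congr rfl fun ω _ => ?_
  rw [rD_univ_eq_avoidEv, mul_comm (F _)]

/-- `X_F(Y) = Σ_ω w(ω) 1{x ↮ Y} q_S(V ∖ C_Y ω) F(V ∖ C_Y ω)` on the whole graph. [folklore] -/
theorem Xw_univ (w : Sym2 V → ℝ) (x : V) (S : Set V) (o v : V) (F : Finset V → ℝ) (Y : Set V) :
    Xw w Finset.univ x S o v F Y =
      ∑ ω, weight w ω * (ind (avoidEv x Y) ω * (qav w (rest Finset.univ Y ω) S o v * F (rest Finset.univ Y ω))) := by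
  unfold Xw
  refine Finset.sum_congr rfl fun ω _ => ?_
  rw [rD_univ_eq_avoidEv]; ring

/-! ### (Htw) in the world vocabulary -/

/-- **(Htw) in the world vocabulary of the CSH chain**: for a marker set `S ∋ x` with `v ∉ S`, every source set `Y`,
every monotone edge-cluster functional `g ≥ 0` and normalised weights `w ∈ [0,1]`,
`μ(v↔o, v↮S∪Y) · Σ_ω w 1{x↮Y} Cov_{G−cut Y ω}(g(C_x), 1{v↔S}) ≤ μ(v↮S∪Y) · Σ_ω w 1{x↮Y} p^S_ω Cov_{G−cut Y ω}(g(C_x), 1{v↔S})`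
with `p^S_ω = μ_{G−cut Y ω}(v↔o, v↮S)/μ_{G−cut Y ω}(v↮S)` (PROOF-S5-ALL-R (K9)/(Htw); socket P4 output).
[cite: VandenbergHaggstromKahn2005, Thm. 1.1 (pp. 3–5), Thm. 1.4 (p. 7)] [cite: Gladkov2024, Thm. 3.2 (p. 4)] -/
theorem htw_world (w : Sym2 V → ℝ) (hw0 : ∀ e, 0 ≤ w e) (hw1 : ∀ e, w e ≤ 1) (hm : ∑ ω, weight w ω = 1)
    {x v : V} {S : Set V} (hxS : x ∈ S) (hvS : v ∉ S) (o : V) {g : Set (Sym2 V) → ℝ} (hg : Monotone g)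
    (hg0 : ∀ C, 0 ≤ g C) (Y : Set V) :
    (∑ ω, weight w ω * ind (avoidEv v (S ∪ Y) ∩ (openConn v o : Set (BondConfig V))) ω) *
        (∑ ω, weight w ω * (ind (avoidEv x Y) ω *
          wcovOff w Y (fun β => g (openEdgeCluster β x))
            (ind {β : Set (Sym2 V) | ∃ s ∈ S, (openGraph β).Reachable s v}) ω)) ≤
      (∑ ω, weight w ω * ind (avoidEv v (S ∪ Y)) ω) *
        (∑ ω, weight w ω * (ind (avoidEv x Y) ω *
          (wmeanOff w Y (ind (avoidEv v S ∩ (openConn v o : Set (BondConfig V)))) ω /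
              wmeanOff w Y (ind (avoidEv v S)) ω *
            wcovOff w Y (fun β => g (openEdgeCluster β x))
              (ind {β : Set (Sym2 V) | ∃ s ∈ S, (openGraph β).Reachable s v}) ω))) := by
  have h := p1H_univ w hw0 hw1 hm hxS hvS o hg hg0 Y
  rw [Eav_univ, Mav_univ, Yw_univ, Xw_univ] at h
  simp only [BfS_rest_univ, qav_rest_univ] at h
  exact h

omit [Fintype V] in
/-- `{β | ∃ s ∈ {x, d}, s ↔ v} = openConn x v ∪ openConn d v`. [folklore] -/
theorem setOf_exists_mem_pair_reachable (x d v : V) :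
    {β : Set (Sym2 V) | ∃ s ∈ ({x, d} : Set V), (openGraph β).Reachable s v} =
      (openConn x v : Set (BondConfig V)) ∪ openConn d v := by
  ext β
  simp only [mem_setOf_eq, mem_insert_iff, mem_singleton_iff, exists_eq_or_imp, exists_eq_left, mem_union]
  rfl

/-- **(Htw) for the marker set `S = {x, d}`** (owner and one decoy — the H-part of `CSH.unfold_one`, threshold
form): with `v ≠ x`, `v ≠ d`,
`μ(v↔o, v↮{x,d}∪Y) · Σ_ω w 1{x↮Y} Cov_ω(g(C_x), 1{v↔x ∨ v↔d}) ≤ μ(v↮{x,d}∪Y) · Σ_ω w 1{x↮Y} p_ω Cov_ω(g(C_x), 1{v↔x ∨ v↔d})`.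
[cite: VandenbergHaggstromKahn2005, Thm. 1.1 (pp. 3–5), Thm. 1.4 (p. 7)] [cite: Gladkov2024, Thm. 3.2 (p. 4)] -/
theorem htw_world_pair (w : Sym2 V → ℝ) (hw0 : ∀ e, 0 ≤ w e) (hw1 : ∀ e, w e ≤ 1) (hm : ∑ ω, weight w ω = 1)
    (x d o v : V) (hvx : v ≠ x) (hvd : v ≠ d) {g : Set (Sym2 V) → ℝ} (hg : Monotone g)
    (hg0 : ∀ C, 0 ≤ g C) (Y : Set V) :
    (∑ ω, weight w ω * ind (avoidEv v (insert x (insert d Y)) ∩ (openConn v o : Set (BondConfig V))) ω) *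
        (∑ ω, weight w ω * (ind (avoidEv x Y) ω *
          wcovOff w Y (fun β => g (openEdgeCluster β x))
            (ind ((openConn x v : Set (BondConfig V)) ∪ openConn d v)) ω)) ≤
      (∑ ω, weight w ω * ind (avoidEv v (insert x (insert d Y))) ω) *
        (∑ ω, weight w ω * (ind (avoidEv x Y) ω *
          (wmeanOff w Y (ind (avoidEv v {x, d} ∩ (openConn v o : Set (BondConfig V)))) ω /
              wmeanOff w Y (ind (avoidEv v {x, d})) ω *
            wcovOff w Y (fun β => g (openEdgeCluster β x))
              (ind ((openConn x v : Set (BondConfig V)) ∪ openConn d v)) ω))) := by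
  have h := htw_world w hw0 hw1 hm (S := ({x, d} : Set V)) (x := x) (v := v)
    (by simp) (by simp [hvx, hvd]) o hg hg0 Y
  have hS : ({x, d} : Set V) ∪ Y = insert x (insert d Y) := by
    ext u; simp only [mem_union, mem_insert_iff, mem_singleton_iff]; tauto
  rw [setOf_exists_mem_pair_reachable, hS] at h
  exact h

/-! ### The form consumed by the level-one cell (`HullPort.hpart_nonneg` / `HullPort.csh_one`, prim-ineq-prove-5) -/

/-- `CSH.wmeanOff` is `HullPort.delE` at the cut. [folklore] -/
theorem wmeanOff_eq_delE (w : Sym2 V → ℝ) (Y : Set V) (φ : Set (Sym2 V) → ℝ) (ω : Set (Sym2 V)) :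
    wmeanOff w Y φ ω = delE w (cut Y ω) φ := rfl

/-- `CSH.wcovOff` is `HullPort.covW`. [folklore] -/
theorem wcovOff_eq_covW (w : Sym2 V → ℝ) (Y : Set V) (φ ψ : Set (Sym2 V) → ℝ) (ω : Set (Sym2 V)) :
    wcovOff w Y φ ψ ω = HullPort.covW w Y φ ψ ω := rfl

omit [Fintype V] in
/-- `{r ↮ T}` written from the side of `T`. [folklore] -/
theorem avoidEv_eq_setOf_symm (r : V) (T : Set V) :
    avoidEv r T = {ζ : Set (Sym2 V) | ∀ t ∈ T, ¬ (openGraph ζ).Reachable t r} := by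
  ext ζ
  exact ⟨fun h t ht hr => h t ht hr.symm, fun h t ht hr => h t ht hr.symm⟩

/-- **(Htw) in the `delE`/`covW` form of the level-one cell** — literally the hypothesis `HTW` of prim-ineq-prove-5's
`HullPort.hpart_nonneg` / `HullPort.csh_one`: for weights `q < 1`, owner `x`, decoy `d`, observers `o, v` with
`v ∉ {x, d} ∪ Y`, the threshold `p = μ(v ↔ o | v ↮ {x,d} ∪ Y)` (given by its defining equation) and every monotone
edge-cluster functional `g ≥ 0`,
`0 ≤ Σ_ω q(ω) 1{x ↮ Y}(ω) · (p_ω − p) · Cov_{G − cut Y ω}(g(C_x), 1{v ↔ {x,d}})`, `p_ω = μ_{G−cut Y ω}(v↔o, v↮{x,d})/μ_{G−cut Y ω}(v↮{x,d})`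
(PROOF-S5-ALL-R (K9), display (Htw); socket piece P4, A2 route).
[cite: VandenbergHaggstromKahn2005, Thm. 1.1 (pp. 3–5), Thm. 1.4 (p. 7)] [cite: Gladkov2024, Thm. 3.2 (p. 4)] -/
theorem htw_delE (q : Sym2 V → unitInterval) (hq : ∀ e, (q e : ℝ) < 1) (x d o v : V) (Y : Set V)
    (hvx : v ≠ x) (hvd : v ≠ d) (hvY : v ∉ Y) (p : ℝ)
    (hp : p * (prodBernoulli q).real
        {ω : BondConfig V | ∀ t ∈ insert d (insert x Y), ¬ (openGraph ω).Reachable v t} =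
      (prodBernoulli q).real
        ({ω : BondConfig V | ∀ t ∈ insert d (insert x Y), ¬ (openGraph ω).Reachable v t} ∩ openConn v o))
    (g : Set (Sym2 V) → ℝ) (hg : Monotone g) (hg0 : ∀ C, 0 ≤ g C) :
    0 ≤ ∑ ω, weight (fun e => (q e : ℝ)) ω * (ind (avoidEv x Y) ω *
        ((delE (fun e => (q e : ℝ)) (cut Y ω)
              (ind ({ζ : BondConfig V | ∀ s ∈ ({x, d} : Set V), ¬ (openGraph ζ).Reachable s v} ∩ openConn o v)) /
            delE (fun e => (q e : ℝ)) (cut Y ω)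
              (ind {ζ : BondConfig V | ∀ s ∈ ({x, d} : Set V), ¬ (openGraph ζ).Reachable s v}) - p) *
          HullPort.covW (fun e => (q e : ℝ)) Y (fun η => g (openEdgeCluster η x))
            (ind {ζ : BondConfig V | ∃ s ∈ ({x, d} : Set V), (openGraph ζ).Reachable s v}) ω)) := by
  set ŵ : Sym2 V → ℝ := fun e => (q e : ℝ) with hŵ
  have hw0 : ∀ e, 0 ≤ ŵ e := fun e => (q e).2.1
  have hw1 : ∀ e, ŵ e ≤ 1 := fun e => (q e).2.2
  have hq' : ∀ e, ŵ e < 1 := hq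
  have hm : ∑ ω, weight ŵ ω = 1 := sum_weight_coe_eq_one q
  -- (Htw) for the marker set `S = {x, d}` in the world vocabulary
  have h := htw_world ŵ hw0 hw1 hm (S := ({x, d} : Set V)) (x := x) (v := v) (by simp) (by simp [hvx, hvd]) o hg hg0 Y
  -- the sets
  have hS : ({x, d} : Set V) ∪ Y = insert d (insert x Y) := by
    ext u; simp only [mem_union, mem_insert_iff, mem_singleton_iff]; tauto
  have hA : avoidEv v ({x, d} : Set V) = {ζ : Set (Sym2 V) | ∀ s ∈ ({x, d} : Set V), ¬ (openGraph ζ).Reachable s v} :=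
    avoidEv_eq_setOf_symm v _
  have hO : (openConn v o : Set (BondConfig V)) = openConn o v := KNPreFKG.openConn_symm v o
  rw [hS] at h
  simp only [hA, hO, wmeanOff_eq_delE, wcovOff_eq_covW] at h
  -- the two global masses
  set α : ℝ := ∑ ω, weight ŵ ω * ind (avoidEv v (insert d (insert x Y))) ω with hαdef
  set β : ℝ := ∑ ω, weight ŵ ω * ind (avoidEv v (insert d (insert x Y)) ∩ (openConn o v : Set (BondConfig V))) ω
    with hβdef
  have hαμ : α = (prodBernoulli q).real
      {ω : BondConfig V | ∀ t ∈ insert d (insert x Y), ¬ (openGraph ω).Reachable v t} := sum_weight_ind q _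
  have hβμ : β = (prodBernoulli q).real
      ({ω : BondConfig V | ∀ t ∈ insert d (insert x Y), ¬ (openGraph ω).Reachable v t} ∩ openConn v o) := by
    rw [hβdef, ← hO]; exact sum_weight_ind q _
  have hpα : p * α = β := by rw [hαμ, hβμ]; exact hp
  have hαpos : 0 < α := by
    have := HullPort.tab_pos ŵ hw0 hq' d v (insert x Y) (by simp [hvx, hvd, hvY])
    simpa only [HullPort.tab] using this
  -- the two world sums
  set A : ℝ := ∑ ω, weight ŵ ω * (ind (avoidEv x Y) ω *
      HullPort.covW ŵ Y (fun η => g (openEdgeCluster η x))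
        (ind {ζ : BondConfig V | ∃ s ∈ ({x, d} : Set V), (openGraph ζ).Reachable s v}) ω) with hAdef
  set B : ℝ := ∑ ω, weight ŵ ω * (ind (avoidEv x Y) ω *
      (delE ŵ (cut Y ω)
            (ind ({ζ : BondConfig V | ∀ s ∈ ({x, d} : Set V), ¬ (openGraph ζ).Reachable s v} ∩ openConn o v)) /
          delE ŵ (cut Y ω) (ind {ζ : BondConfig V | ∀ s ∈ ({x, d} : Set V), ¬ (openGraph ζ).Reachable s v}) *
        HullPort.covW ŵ Y (fun η => g (openEdgeCluster η x))
          (ind {ζ : BondConfig V | ∃ s ∈ ({x, d} : Set V), (openGraph ζ).Reachable s v}) ω)) with hBdef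
  change β * A ≤ α * B at h
  -- the target is `B − p·A`
  have e : ∀ ω : Set (Sym2 V),
      weight ŵ ω * (ind (avoidEv x Y) ω *
        ((delE ŵ (cut Y ω)
              (ind ({ζ : BondConfig V | ∀ s ∈ ({x, d} : Set V), ¬ (openGraph ζ).Reachable s v} ∩ openConn o v)) /
            delE ŵ (cut Y ω) (ind {ζ : BondConfig V | ∀ s ∈ ({x, d} : Set V), ¬ (openGraph ζ).Reachable s v}) - p) *
          HullPort.covW ŵ Y (fun η => g (openEdgeCluster η x))
            (ind {ζ : BondConfig V | ∃ s ∈ ({x, d} : Set V), (openGraph ζ).Reachable s v}) ω)) =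
      weight ŵ ω * (ind (avoidEv x Y) ω *
        (delE ŵ (cut Y ω)
              (ind ({ζ : BondConfig V | ∀ s ∈ ({x, d} : Set V), ¬ (openGraph ζ).Reachable s v} ∩ openConn o v)) /
            delE ŵ (cut Y ω) (ind {ζ : BondConfig V | ∀ s ∈ ({x, d} : Set V), ¬ (openGraph ζ).Reachable s v}) *
          HullPort.covW ŵ Y (fun η => g (openEdgeCluster η x))
            (ind {ζ : BondConfig V | ∃ s ∈ ({x, d} : Set V), (openGraph ζ).Reachable s v}) ω)) -
      p * (weight ŵ ω * (ind (avoidEv x Y) ω *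
        HullPort.covW ŵ Y (fun η => g (openEdgeCluster η x))
          (ind {ζ : BondConfig V | ∃ s ∈ ({x, d} : Set V), (openGraph ζ).Reachable s v}) ω)) := fun ω => by ring
  rw [Finset.sum_congr rfl fun ω _ => e ω, Finset.sum_sub_distrib, ← Finset.mul_sum]
  change 0 ≤ B - p * A
  have h' : α * (p * A) ≤ α * B := by
    calc α * (p * A) = β * A := by rw [← hpα]; ring
      _ ≤ α * B := h
  exact sub_nonneg.2 (le_of_mul_le_mul_left h' hαpos)

end Summit.CriticalPhenomena.PercolationContinuityZ3.Theorems.CovTau
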